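import Literature.Analysis.FluidPDE.PassiveScalar
import Literature.Analysis.FluidPDE.NSViscosityRescaling
import Literature.Analysis.FluidPDE.ForwardDSSExistenceLocalProofs
import Literature.Analysis.FunctionSpaces.TorusSpectralWeakDerivative
import HarnessLib

/-!
# Negative knowledge for the crux `RelaxingFamily` (stmt-AnomalousDissipation-15009), IV-a: time
# dilation of weak scalar solutions (tool file)

Tool for the quantitative Seis floor `Negative/SublogBudget.lean` (supports stmt-AnomalousDissipation-15009;
route `route-AnomalousDissipation-LimitingAbsorption`, crux r3). The scaling note of
`Literature/Analysis/FluidPDE/SeisDissipationRateBound.lean` ("for a budget `‖∇u‖ ≤ G` apply the fact to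
`t ↦ θ(t/G)`, velocity `u/G`, diffusivity `κ/G`") made formal for the tree's weak class:

* `isWeakScalarTransportOn_comp_mul` — if `θ` solves `∂ₜθ + u·∇θ = κΔθ`, `θ(0) = θ₀` weakly on
  `T^d × [0, cS)` (`Torus.IsWeakScalarTransportOn`, `c > 0`), then `t ↦ θ(ct)` solves the equation with
  drift `c u(c ·)` and diffusivity `cκ` weakly on `[0, S)` from the same datum: test the original
  identity with the dilated test field `ψ(c⁻¹ ·)` (`isSpaceTimeTest_comp_inv_mul`,
  `timeDeriv_comp_inv_mul`) and change variables `s = ct` (`setIntegral_Ioo_comp_mul`); every side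
  condition of the weak class (space–time measurability, `L^∞_t L²_x`, `L¹_t L²_x` drift, `uθ ∈ L¹`,
  weak incompressibility) transforms by the same change of variables
  (`aestronglyMeasurable_stLift_comp_mul`, `ae_restrict_Ioo_comp_mul`, `setLIntegral_Ioo_comp_mul`,
  `isWeaklyDivFree_const_smul`);
* `eGradNormSq_const_smul_eq` — `‖∇(c • w)‖₂² = c²‖∇w‖₂²`.

## References

* C. Seis, Comm. Math. Phys. 399 (2023) = arXiv:2003.08794, scaling remark p. 4. [`Seis2022`]
* R. J. DiPerna, P.-L. Lions, Invent. Math. 98 (1989), §II.1 (the weak class). [`DiPernaLions1989`]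
-/

noncomputable section

open MeasureTheory Set Filter Function TopologicalSpace Topology
open scoped ENNReal NNReal InnerProductSpace

namespace Summit.AnomalousDissipation.AnomalousDissipation.Theorems.RelaxingFamily.Negative

-- D-0017: single-problem summit ⇒ `Summit.AnomalousDissipation.AnomalousDissipation.…` by design.
set_option linter.dupNamespace false

open Literature.Analysis.FunctionSpaces Literature.Analysis.FunctionSpaces.Torus
open Literature.Analysis.FluidPDE Literature.Analysis.FluidPDE.Torus

variable {d : Type*} [Fintype d]

/-! ## One-dimensional change of variables `t ↦ c t` -/

/-- `t ∈ (0, S) ↔ c t ∈ (0, c S)` for `c > 0`. [folklore] -/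
theorem mul_mem_Ioo_iff {c S t : ℝ} (hc : 0 < c) : c * t ∈ Ioo 0 (c * S) ↔ t ∈ Ioo 0 S := by
  constructor
  · rintro ⟨h1, h2⟩
    exact ⟨pos_of_mul_pos_right h1 hc.le, lt_of_mul_lt_mul_left h2 hc.le⟩
  · rintro ⟨h1, h2⟩
    exact ⟨mul_pos hc h1, mul_lt_mul_of_pos_left h2 hc⟩

/-- Transport of a.e. statements along `t ↦ c t`, interval version. [folklore] -/
theorem ae_restrict_Ioo_comp_mul {c S : ℝ} (hc : 0 < c) {P : ℝ → Prop}
    (h : ∀ᵐ s ∂(volume.restrict (Ioo 0 (c * S))), P s) :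
    ∀ᵐ t ∂(volume.restrict (Ioo 0 S)), P (c * t) := by
  rw [ae_restrict_iff' measurableSet_Ioo] at h ⊢
  filter_upwards [(quasiMeasurePreserving_mul_left hc.ne').ae h] with t ht hts
  exact ht ((mul_mem_Ioo_iff hc).2 hts)

/-- Transport of a.e. statements along `t ↦ c t`, half-line version. [folklore] -/
theorem ae_restrict_Ioi_comp_mul {c : ℝ} (hc : 0 < c) {P : ℝ → Prop}
    (h : ∀ᵐ s ∂(volume.restrict (Ioi (0 : ℝ))), P s) :
    ∀ᵐ t ∂(volume.restrict (Ioi (0 : ℝ))), P (c * t) := by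
  rw [ae_restrict_iff' measurableSet_Ioi] at h ⊢
  filter_upwards [(quasiMeasurePreserving_mul_left hc.ne').ae h] with t ht hts
  exact ht (mul_pos hc hts)

/-- `∫_{(0,S)} G(c t) dt = c⁻¹ ∫_{(0,cS)} G` for `c > 0` (lower Lebesgue integral). [folklore] -/
theorem setLIntegral_Ioo_comp_mul (G : ℝ → ℝ≥0∞) {c : ℝ} (hc : 0 < c) (S : ℝ) :
    ∫⁻ t in Ioo 0 S, G (c * t) = ENNReal.ofReal c⁻¹ * ∫⁻ s in Ioo 0 (c * S), G s := by
  have h := setLIntegral_Ioo_comp_inv_mul G (inv_pos.2 hc) (c * S)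
  rwa [inv_inv, inv_mul_cancel_left₀ hc.ne'] at h

/-- `∫_{(0,S)} Φ(c t) dt = c⁻¹ ∫_{(0,cS)} Φ` for `c > 0` (Bochner integral, real values). [folklore] -/
theorem setIntegral_Ioo_comp_mul (Φ : ℝ → ℝ) {c : ℝ} (hc : 0 < c) (S : ℝ) :
    ∫ t in Ioo 0 S, Φ (c * t) = c⁻¹ * ∫ s in Ioo 0 (c * S), Φ s := by
  rw [← integral_indicator measurableSet_Ioo, ← integral_indicator measurableSet_Ioo]
  have hind : (fun t => (Ioo 0 S).indicator (fun t => Φ (c * t)) t) =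
      fun t => (Ioo 0 (c * S)).indicator Φ (c * t) := by
    funext t
    by_cases ht : t ∈ Ioo 0 S
    · rw [indicator_of_mem ht, indicator_of_mem ((mul_mem_Ioo_iff hc).2 ht)]
    · rw [indicator_of_notMem ht, indicator_of_notMem (mt (mul_mem_Ioo_iff hc).1 ht)]
  rw [hind, Measure.integral_comp_mul_left (fun s => (Ioo 0 (c * S)).indicator Φ s) c, smul_eq_mul,
    abs_of_pos (inv_pos.2 hc)]

/-! ## Space–time measurability under time dilation -/

omit [Fintype d] in
/-- The dilation `(t, y) ↦ (c t, y)` is quasi-measure-preserving on `ℝ × ℝ^d`. [folklore] -/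
theorem quasiMeasurePreserving_prodMap_const_mul [Fintype d] {c : ℝ} (hc : c ≠ 0) :
    Measure.QuasiMeasurePreserving
      (Prod.map (fun t : ℝ => c * t) (id : EuclideanSpace ℝ d → EuclideanSpace ℝ d)) volume volume :=
  MeasureTheory.QuasiMeasurePreserving.prodMap (quasiMeasurePreserving_mul_left hc)
    (Measure.QuasiMeasurePreserving.id volume)

/-- **Measurability of the dilate.** If the space–time lift of `θ` is a.e. strongly measurable on
`(0, cS) × ℝ^d` (`c > 0`), then the lift of `t ↦ θ (c t)` is a.e. strongly measurable on
`(0, S) × ℝ^d`. [folklore] -/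
theorem aestronglyMeasurable_stLift_comp_mul {F : Type*} [TopologicalSpace F]
    {θ : ℝ → UnitAddTorus d → F} {c S : ℝ} (hc : 0 < c)
    (h : AEStronglyMeasurable (stLift θ) (volume.restrict (Ioo 0 (c * S) ×ˢ univ))) :
    AEStronglyMeasurable (stLift fun t => θ (c * t)) (volume.restrict (Ioo 0 S ×ˢ univ)) := by
  set e : ℝ × EuclideanSpace ℝ d → ℝ × EuclideanSpace ℝ d :=
    Prod.map (fun t : ℝ => c * t) (id : EuclideanSpace ℝ d → EuclideanSpace ℝ d) with he
  have hq := quasiMeasurePreserving_prodMap_const_mul (d := d) hc.ne'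
  have hpre : e ⁻¹' (Ioo 0 (c * S) ×ˢ (univ : Set (EuclideanSpace ℝ d))) = Ioo 0 S ×ˢ univ := by
    ext p
    simp only [he, mem_preimage, mem_prod, Prod.map_fst, Prod.map_snd, mem_univ, and_true]
    exact mul_mem_Ioo_iff hc
  have hq' : Measure.QuasiMeasurePreserving e (volume.restrict (Ioo 0 S ×ˢ univ))
      (volume.restrict (Ioo 0 (c * S) ×ˢ univ)) := by
    refine ⟨hq.measurable, ?_⟩
    rw [← hpre, ← Measure.restrict_map hq.measurable (measurableSet_Ioo.prod MeasurableSet.univ)]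
    exact hq.absolutelyContinuous.restrict _
  have hcomp : (stLift fun t => θ (c * t)) = stLift θ ∘ e := by
    funext p; rfl
  rw [hcomp]
  exact h.comp_quasiMeasurePreserving hq'

/-! ## Test fields under time dilation -/

/-- The dilate `ψ(c⁻¹ ·)` of a space–time test field on `[0, S)` is a test field on `[0, cS)`. [folklore] -/
theorem isSpaceTimeTest_comp_inv_mul {S c : ℝ} (hc : 0 < c) {ψ : ℝ → UnitAddTorus d → ℝ}
    (hψ : IsSpaceTimeTest S ψ) : IsSpaceTimeTest (c * S) (fun t x => ψ (c⁻¹ * t) x) := by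
  obtain ⟨hs, T', hT', h0⟩ := hψ
  refine ⟨?_, c * T', mul_lt_mul_of_pos_left hT' hc, fun t ht => ?_⟩
  · have e : (stLift fun t x => ψ (c⁻¹ * t) x) =
        stLift ψ ∘ fun p : ℝ × EuclideanSpace ℝ d => (c⁻¹ * p.1, p.2) := by
      funext p; rfl
    rw [e]
    exact hs.comp ((contDiff_const.mul contDiff_fst).prodMk contDiff_snd)
  · have h1 : T' ≤ c⁻¹ * t := by
      rw [le_inv_mul_iff₀ hc]; exact ht
    show (fun x => ψ (c⁻¹ * t) x) = 0
    exact h0 _ h1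

/-- Time derivative of the dilate: `∂ₜ[ψ(c⁻¹ ·)](t) = c⁻¹ (∂ₜψ)(c⁻¹ t)`. [folklore] -/
theorem timeDeriv_comp_inv_mul {S c : ℝ} {ψ : ℝ → UnitAddTorus d → ℝ}
    (hψ : IsSpaceTimeTest S ψ) (t : ℝ) (x : UnitAddTorus d) :
    Literature.Analysis.FunctionSpaces.Torus.timeDeriv (fun t x => ψ (c⁻¹ * t) x) t x =
      c⁻¹ * Literature.Analysis.FunctionSpaces.Torus.timeDeriv ψ (c⁻¹ * t) x := by
  obtain ⟨y, hy⟩ := proj_surjective x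
  have hdiff : Differentiable ℝ fun τ => ψ τ x := by
    have e : (fun τ => ψ τ x) = fun τ => stLift ψ (τ, y) := by
      funext τ; rw [stLift_apply, hy]
    rw [e]
    exact (hψ.1.comp (contDiff_prodMk_left y)).differentiable (by simp)
  have h1 : HasDerivAt (fun τ : ℝ => c⁻¹ * τ) c⁻¹ t := by
    simpa using (hasDerivAt_id t).const_mul c⁻¹
  have h2 : HasDerivAt (fun τ => ψ τ x) (deriv (fun τ => ψ τ x) (c⁻¹ * t)) (c⁻¹ * t) :=
    (hdiff _).hasDerivAt
  have h := h2.scomp t h1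
  show deriv (fun τ => ψ (c⁻¹ * τ) x) t = c⁻¹ * deriv (fun τ => ψ τ x) (c⁻¹ * t)
  rw [show (fun τ => ψ (c⁻¹ * τ) x) = (fun τ => ψ τ x) ∘ fun τ => c⁻¹ * τ from rfl, h.deriv,
    smul_eq_mul]

/-- Weakly divergence-free fields are closed under scalar multiplication. [folklore] -/
theorem isWeaklyDivFree_const_smul {u : UnitAddTorus d → EuclideanSpace ℝ d}
    (hu : IsWeaklyDivFree u) (c : ℝ) : IsWeaklyDivFree (c • u) := by
  intro θ hθ
  simp only [Pi.smul_apply, real_inner_smul_left, integral_const_mul, hu θ hθ, mul_zero]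

/-! ## Time dilation of weak scalar solutions -/

/-- **Time dilation of weak solutions.** If `θ` is a weak solution of `∂ₜθ + u·∇θ = κΔθ`,
`θ(0) = θ₀` on `T^d × [0, cS)` and `c > 0`, then `t ↦ θ(ct)` is a weak solution of the equation
with drift `t ↦ c u(ct)` and diffusivity `cκ` on `[0, S)` from the same datum (test the original
equation with `ψ(c⁻¹ ·)` and change variables `s = ct` in the time integral; every side condition
of the weak class transforms by the same change of variables). [folklore] -/
theorem isWeakScalarTransportOn_comp_mul [DecidableEq d] {S κ c : ℝ}
    {u : ℝ → UnitAddTorus d → EuclideanSpace ℝ d} {θ₀ : UnitAddTorus d → ℝ}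
    {θ : ℝ → UnitAddTorus d → ℝ} (hc : 0 < c) (h : IsWeakScalarTransportOn (c * S) κ u θ₀ θ) :
    IsWeakScalarTransportOn S (c * κ) (fun t => c • u (c * t)) θ₀ (fun t => θ (c * t)) where
  aestronglyMeasurable := aestronglyMeasurable_stLift_comp_mul hc h.aestronglyMeasurable
  aestronglyMeasurable_velocity := by
    have e : (stLift fun t => c • u (c * t)) = fun p => c • stLift (fun t => u (c * t)) p := by
      funext p; rfl
    rw [e]
    exact (aestronglyMeasurable_stLift_comp_mul hc h.aestronglyMeasurable_velocity).const_smul c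
  ae_lintegral_sq_le := by
    obtain ⟨C, hC⟩ := h.ae_lintegral_sq_le
    exact ⟨C, ae_restrict_Ioo_comp_mul hc hC⟩
  lintegral_velocity_lt_top := by
    have e : ∀ t, (∫⁻ x, ‖(c • u (c * t)) x‖ₑ ^ 2) ^ (1 / 2 : ℝ) =
        ENNReal.ofReal (c ^ 2) ^ (1 / 2 : ℝ) * (∫⁻ x, ‖u (c * t) x‖ₑ ^ 2) ^ (1 / 2 : ℝ) := by
      intro t
      rw [show (fun x => ‖(c • u (c * t)) x‖ₑ ^ 2) = fun x => ‖c • u (c * t) x‖ₑ ^ 2 from rfl,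
        lintegral_enorm_sq_const_smul, ENNReal.mul_rpow_of_nonneg _ _ (by norm_num)]
    simp_rw [e]
    rw [lintegral_const_mul' _ _ (by simp), setLIntegral_Ioo_comp_mul
      (fun s => (∫⁻ x, ‖u s x‖ₑ ^ 2) ^ (1 / 2 : ℝ)) hc S]
    exact ENNReal.mul_lt_top (ENNReal.rpow_lt_top_of_nonneg (by norm_num) ENNReal.ofReal_ne_top)
      (ENNReal.mul_lt_top (by simp) h.lintegral_velocity_lt_top)
  lintegral_mul_lt_top := by
    have e : ∀ t, ∫⁻ x, ‖(c • u (c * t)) x‖ₑ * ‖θ (c * t) x‖ₑ =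
        ‖c‖ₑ * ∫⁻ x, ‖u (c * t) x‖ₑ * ‖θ (c * t) x‖ₑ := by
      intro t
      rw [← lintegral_const_mul' _ _ (by simp)]
      refine lintegral_congr fun x => ?_
      rw [Pi.smul_apply, enorm_smul, mul_assoc]
    simp_rw [e]
    rw [lintegral_const_mul' _ _ (by simp), setLIntegral_Ioo_comp_mul
      (fun s => ∫⁻ x, ‖u s x‖ₑ * ‖θ s x‖ₑ) hc S]
    exact ENNReal.mul_lt_top (by simp) (ENNReal.mul_lt_top (by simp) h.lintegral_mul_lt_top)
  ae_isWeaklyDivFree := by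
    filter_upwards [ae_restrict_Ioo_comp_mul hc h.ae_isWeaklyDivFree] with t ht
    exact isWeaklyDivFree_const_smul ht c
  weak_eq ψ hψ := by
    -- test the original equation with the dilated test field `ψ(c⁻¹ ·)`
    set ψ' : ℝ → UnitAddTorus d → ℝ := fun t x => ψ (c⁻¹ * t) x with hψ'
    have key := h.weak_eq ψ' (isSpaceTimeTest_comp_inv_mul hc hψ)
    have h0 : ψ' 0 = ψ 0 := by
      funext x; simp [hψ']
    rw [h0] at key
    -- the time integrand of the original identity
    set Φ : ℝ → ℝ := fun s => ∫ x, θ s x *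
      (Literature.Analysis.FunctionSpaces.Torus.timeDeriv ψ' s x + ⟪u s x, Torus.gradient (ψ' s) x⟫_ℝ +
        κ * Torus.laplacian (ψ' s) x) with hΦ
    have hslice : ∀ t, ψ' (c * t) = ψ t := fun t => by
      funext x; simp only [hψ', inv_mul_cancel_left₀ hc.ne']
    have hc0 : c ≠ 0 := hc.ne'
    have htd : ∀ s y, Literature.Analysis.FunctionSpaces.Torus.timeDeriv ψ' s y =
        c⁻¹ * Literature.Analysis.FunctionSpaces.Torus.timeDeriv ψ (c⁻¹ * s) y := fun s y => by
      simp only [hψ']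
      exact timeDeriv_comp_inv_mul hψ s y
    have hpt : ∀ t, (∫ x, θ (c * t) x *
        (Literature.Analysis.FunctionSpaces.Torus.timeDeriv ψ t x + ⟪(fun t => c • u (c * t)) t x, Torus.gradient (ψ t) x⟫_ℝ +
          c * κ * Torus.laplacian (ψ t) x)) = c * Φ (c * t) := by
      intro t
      simp only [hΦ]
      rw [← integral_const_mul]
      refine integral_congr_ae (ae_of_all _ fun x => ?_)
      beta_reduce
      rw [htd, inv_mul_cancel_left₀ hc0, hslice t]
      simp only [Pi.smul_apply, real_inner_smul_left]
      field_simp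
    have hint : (∫ t in Ioo 0 S, ∫ x, θ (c * t) x *
        (Literature.Analysis.FunctionSpaces.Torus.timeDeriv ψ t x + ⟪(fun t => c • u (c * t)) t x, Torus.gradient (ψ t) x⟫_ℝ +
          c * κ * Torus.laplacian (ψ t) x)) = ∫ s in Ioo 0 (c * S), Φ s := by
      simp_rw [hpt]
      rw [integral_const_mul, setIntegral_Ioo_comp_mul Φ hc S, ← mul_assoc, mul_inv_cancel₀ hc.ne',
        one_mul]
    rw [hint]
    exact key


/-! ## Scaling of the spectral enstrophy -/

omit [Fintype d] in
/-- `‖∇(c • w)‖₂² = c² ‖∇w‖₂²` (the Fourier coefficients scale by `c`). [folklore] -/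
theorem eGradNormSq_const_smul_eq [Fintype d] (c : ℝ) (w : UnitAddTorus d → EuclideanSpace ℝ d) :
    eGradNormSq (c • w) = ENNReal.ofReal (c ^ 2) * eGradNormSq w := by
  have hcs : EuclideanSpace.complexify ∘ (c • w) = (c : ℂ) • (EuclideanSpace.complexify ∘ w) := by
    funext x
    ext i
    simp [EuclideanSpace.complexify_apply]
  rw [eGradNormSq_eq_tsum, eGradNormSq_eq_tsum]
  have hterm : ∀ k : d → ℤ, ENNReal.ofReal (freqNormSq k) *
      ‖UnitAddTorus.mFourierCoeff (EuclideanSpace.complexify ∘ (c • w)) k‖ₑ ^ 2 =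
        ENNReal.ofReal (c ^ 2) * (ENNReal.ofReal (freqNormSq k) *
          ‖UnitAddTorus.mFourierCoeff (EuclideanSpace.complexify ∘ w) k‖ₑ ^ 2) := by
    intro k
    rw [hcs, mFourierCoeff_const_smul, enorm_smul, mul_pow]
    have h2 : ‖(c : ℂ)‖ₑ ^ 2 = ENNReal.ofReal (c ^ 2) := by
      rw [← ofReal_norm, Complex.norm_real, Real.norm_eq_abs, ← ENNReal.ofReal_pow (abs_nonneg c),
        sq_abs]
    rw [h2]
    ring
  simp_rw [hterm]
  rw [ENNReal.tsum_mul_left]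
  ring

end Summit.AnomalousDissipation.AnomalousDissipation.Theorems.RelaxingFamily.Negative

end
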